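import Summits.BirchSwinnertonDyer.BirchSwinnertonDyer.Theorems.ByReductionTypeAtTwoTowerLayerRank
import Summits.BirchSwinnertonDyer.Rank1Residual.Partition.X10CongruenceTransfer
import Summits.BirchSwinnertonDyer.Rank1Residual.Partition.X10DescentRowC16
import Literature.NumberTheory.EllipticCurves.SelmerCorankAssembly
import Literature.NumberTheory.EllipticCurves.SelmerCorankControlRatProofs
import Literature.NumberTheory.EllipticCurves.PointDivisibilityProofs
import Literature.NumberTheory.EllipticCurves.AnomalousOfRationalTorsionProofs
import HarnessLib

/-!
# Row C16 / class X10a′ at `p = 3` WITHOUT Beilinson–Flach and WITHOUT a partner curve: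
# Mazur's main conjecture and `BSD(E,3)` by the `λ`-STRUCTURE road —
# Kato 17.4 (3) + Greenberg 1999 Prop. 4.14 + {`λ_an = n`, `μ_an = 0`, `3ⁿ ≤ #Sel^(3)(E/ℚ)`}
# (cell `bsd-litref`, paper sub-dir `yz26`, seat `bsd-litref-yz26-pv`; LADDER-BSD H0/H1 · W7, row D3)

HONEST FRAMING (programme `BSD-LIT2PART-PROGRAMME-v1.md` §HONESTY, verbatim): «no tranche here
proves BSD; ARM L moves the LITERAL column of an r ≤ 1 census into the
kernel-proved-modulo-named-print column; ARM P changes what «named print» is worth.» Theorems only: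
no definition, no new named fact; every published theorem enters as one of the tree's EXISTING named
facts, taken as a hypothesis. Nothing here changes a label; this is a PER-CURVE CERTIFICATE road
(three finite checks: the analytic `λ`, one unit coefficient, a lower bound for the `3`-Selmer
group) — road (L) of the cell next to K (Kato certificate), G (Greenberg–Vatsal partner), V
(visibility), D (descent + Cassels–Tate + Wuthrich), S (exact Selmer): the partner-free,
Greenberg–Vatsal-free, Cassels–Tate-free twin of road G, and the odd-prime, irreducible-image twin of
the `bsd-2adic` cell's TOWER/LAYER doors (`Theorems/ByReductionTypeAtTwoTowerLayerRank.lean`), whose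
`p`-generic `Λ`-algebra it reuses verbatim.

WHY. Row C16 (`p = 3` good ordinary, `E[3]` irreducible, (Im)) is closed as a CLASS only by Yan–Zhu,
J. Algebra 693 (2026) Thm. 5.11, flag `YZ26@3-BF-ERL-Ohta` (referee C ROUND 361); flag-free, every
class of the row is PROVED by name on one of the roads K/G/V/D/S — the last one, `384400cx1`
(`#Ш_an = 81`, `dim_𝔽₃ Sel^(3) = 2`), only through road G × D (a mod-`3` congruent partner and
Greenberg–Vatsal 2000 Thm. (1.4) at `p = 3`). THIS file is a SECOND road for such curves whose
Iwasawa-theoretic named facts are exactly Kato 2004 Thm. 17.4 (3) and Greenberg 1999 Prop. 4.14.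

THE ROAD (`p` odd, `E` good ordinary at `p`, `E[p]` irreducible, `ρ_{E,p^∞}` onto; `X = X(E/ℚ_∞)`,
`f_X` a generator of `char_Λ X`, `L₀ = ϖ·L_p(f,α) ∈ Λ` with `ϖ = Ω⁺_f/Ω_E` a `p`-adic unit — Mazur
1978, `SkinnerUrban2014.periodUnit_of_mazur`). (1) Kato 17.4 (3) (`kato_divisibility`): `X` torsion,
`L₀ ∈ (f_X)` (`Rank1Residual.divisibility_of_kato_of_surjective_pow`); one unit coefficient of `L₀`
(`AnalyticMuLE W p 0`) gives `μ(L₀) = 0`, so `μ(f_X) = μ(X) = 0`. (2) Greenberg Prop. 4.14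
(`prop414_noFiniteSubmodule_of_not_dvd_torsionOrder`; `p ∤ #E(ℚ)_tors` at an irreducible `p`): `X` has
no non-zero finite submodule, so `#X/(p,T)X ≤ #X/pX = p^{λ(X)}`
(`KatoHalfPinch.le_lambdaInvariant_of_pow_le_natCard_quotient_towerIdeal`). (3) Control, injective
half (`E(ℚ)[p] = 0`): `#Sel_{p^∞}(E/ℚ)[p] ≤ #X/(p,T)X` (`KatoHalfPinch.finite_and_natCard_selmerLayer_pTorsion_le`
at layer `0`); at analytic rank `0` (GZK) the descent count reads `#Sel^(p)(E/ℚ) = #Ш[p] ≤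
#Sel_{p^∞}(E/ℚ)[p]` (`card_selmerGroup_eq_pow_rank_mul`, `exists_mem_selmerGroupPInfty_primaryH1ToH1_eq`);
so `pⁿ ≤ #Sel^(p)` gives `n ≤ λ(X) = λ(f_X)` — the `μ = 0` case of Kundu–Ray's Lemma 2.1 `λ + μ ≥ g`.
(4) Pinch (`KatoHalfPinch.span_eq_span_of_mem_span_of_mu_eq_zero_of_lam_le`): `L₀ ∈ (f_X)`,
`μ(L₀) = μ(f_X) = 0`, `λ(L₀) = λ_an = n ≤ λ(f_X)` ⇒ `(L₀) = (f_X)`: `MazurMainConjecture W p`.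
(5) Rank `0`: `RowC16.bsdp_rankZero_of_mazurMainConjecture` (Greenberg Thm. 4.1, modularity, GZK).

WHAT IS NOT CLAIMED. No class is closed by this file: `λ_an = n`, `μ_an = 0`, `pⁿ ≤ #Sel^(p)` are
per-curve CERTIFICATES (explicit binders) produced by the lane's engines and priced by the referee;
the named facts are hypotheses; nothing is asserted about Yan–Zhu's theorem. The road reaches exactly
the curves with `λ_an(E,p) = dim_𝔽ₚ Sel^(p)(E/ℚ)` (at rank `0`: `= dim Ш(E)[p]`), e.g. `384400cx1` at
`3` (`λ_an = 2 = dim Sel^(3)`, two-engine), and says nothing where `λ_an` exceeds the Selmer rank.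

References: [Kato2004Asterisque] Thm. 17.4 (3) (p. 273); [GreenbergLNM1716] §1 p. 60, §3 pp. 85–86,
Thm. 4.1 (p. 102), Prop. 4.14 (p. 124); [Mazur1978] Cor. 4.1; [Wuthrich2014] Lemma 20 (p. 400);
[GreenbergVatsal2000] p. 4 (after Thm. (1.2)); [Washington1997] §13.2; [SilvermanAEC2009] Thm. X.4.2 (a);
[KunduRay2024] Lemma 2.1; [YanZhu2024MainConjNonCM] Thm. 5.11 = v2 Thm. 4.15;
pub/bsd-litref/yz26/PV-NOTE-lambda-structure-road.md.
-/

set_option autoImplicit false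

noncomputable section

open scoped Classical MatrixGroups ModularForm

open CongruenceSubgroup WeierstrassCurve Literature.NumberTheory.EllipticCurves
  Literature.NumberTheory.EllipticCurves.ModularForms
  Literature.NumberTheory.EllipticCurves.Rank1Residual
  Literature.NumberTheory.EllipticCurves.Rank1Residual.Typed
  Literature.NumberTheory.EllipticCurves.Greenberg1999
  Literature.NumberTheory.EllipticCurves.Wuthrich2014
  Summit.BirchSwinnertonDyer.BirchSwinnertonDyer.Theorems.Rank1ResidualX1Defs
  Summit.BirchSwinnertonDyer.Rank1Residual.X1.MuLambda
  Summit.BirchSwinnertonDyer.Rank1Residual.X1.MuPart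
  Summit.BirchSwinnertonDyer.Rank1Residual.X1.ParitySqueeze
  Summit.BirchSwinnertonDyer.Rank1Residual.X5.TowerGap
  Summit.BirchSwinnertonDyer.BirchSwinnertonDyer.Theorems

universe u

namespace Summit.BirchSwinnertonDyer.Rank1Residual

/-! ### §1 Selmer counts: `#Ш[p] ≤ #Sel_{p^∞}(E/K)[p] ≤ #X/(p,T)X` -/

section Selmer

variable {K : Type u} [Field K] [NumberField K] (W : WeierstrassCurve K) [W.IsElliptic]
  (p : ℕ) [hp : Fact p.Prime]

/-- **`#Ш(E/K)[p] ≤ #Sel_{p^∞}(E/K)[p]`** (when the right side is finite): every `p`-torsion element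
of `Ш(E/K)` is the image under `H¹(K, E[p^∞]) → H¹(K, E)` of a `p`-torsion class of `Sel_{p^∞}(E/K)`
(tree `exists_mem_selmerGroupPInfty_primaryH1ToH1_eq`, from `Sel_{p^∞} ↠ Ш[p^∞]` and the
`p`-divisibility of `E(K) ⊗ ℚ_p/ℤ_p`), and that image lies in `Ш ⊓ H¹(K, E)[p]`
(`selmerGroupPInfty_eq_comap_sha`). [cite: GreenbergLNM1716, §1 p. 54 and §2 p. 63] -/
theorem natCard_sha_inf_torsionBy_le_natCard_selmerGroupPInfty_torsion
    [Finite {z : W.selmerGroupPInfty p // p • z = 0}] :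
    Nat.card (W.sha ⊓ AddSubgroup.torsionBy W.galH1 (p : ℕ) : AddSubgroup W.galH1) ≤
      Nat.card {z : W.selmerGroupPInfty p // p • z = 0} := by
  -- the map `Sel_{p^∞}[p] → Ш ⊓ H¹(K,E)[p]`, `z ↦ (H¹(K,E[p^∞]) → H¹(K,E)) z`
  have hmem : ∀ z : {z : W.selmerGroupPInfty p // p • z = 0},
      W.primaryH1ToH1 p (z.1 : W.galH1Primary p) ∈
        (W.sha ⊓ AddSubgroup.torsionBy W.galH1 (p : ℕ) : AddSubgroup W.galH1) := by
    intro z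
    have hz : W.primaryH1ToH1 p ((z.1 : W.selmerGroupPInfty p) : W.galH1Primary p) ∈ W.sha :=
      AddSubgroup.mem_comap.mp ((W.selmerGroupPInfty_eq_comap_sha p).le z.1.2)
    refine ⟨hz, ?_⟩
    apply (AddSubgroup.torsionBy.nsmul_iff (A := W.galH1) (n := p)).mpr
    have hpz : p • ((z.1 : W.selmerGroupPInfty p) : W.galH1Primary p) = 0 := by
      rw [← AddSubgroupClass.coe_nsmul, z.2, ZeroMemClass.coe_zero]
    rw [← (W.primaryH1ToH1 p).map_nsmul, hpz, map_zero]
  let G : {z : W.selmerGroupPInfty p // p • z = 0} →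
      (W.sha ⊓ AddSubgroup.torsionBy W.galH1 (p : ℕ) : AddSubgroup W.galH1) :=
    fun z ↦ ⟨W.primaryH1ToH1 p (z.1 : W.galH1Primary p), hmem z⟩
  have hG : Function.Surjective G := by
    rintro ⟨s, hs, hsp⟩
    have hps : p • s = 0 := (AddSubgroup.torsionBy.nsmul_iff (A := W.galH1) (n := p)).mp hsp
    obtain ⟨x, hx, hpx, hxs⟩ :=
      W.exists_mem_selmerGroupPInfty_primaryH1ToH1_eq p W.zsmul_geomPoints_surjective_holds hs hps
    refine ⟨⟨⟨x, hx⟩, Subtype.ext ?_⟩, Subtype.ext ?_⟩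
    · rw [AddSubgroupClass.coe_nsmul, ZeroMemClass.coe_zero]
      exact hpx
    · exact hxs
  exact Nat.card_le_card_of_surjective G hG

variable {p} (κ : ZpExtension K p) {γ : Field.absoluteGaloisGroup K}

/-- **`#Sel_{p^∞}(E/K)[p] ≤ #X/(p,T)X`, and `Sel_{p^∞}(E/K)[p]` is finite** — for an elliptic curve
`E = W` over a number field `K` with `E(K)[p] = 0` (`hK`), any `ℤ_p`-extension `κ`, any `γ`, any
Pontryagin-dual datum `D` of `Sel_{p^∞}(E/K_∞)` with `X = D.X` finitely generated. The layer-`0`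
statement `KatoHalfPinch.finite_and_natCard_selmerLayer_pTorsion_le` (Greenberg's injective control
map `s_0` and the pairing of `(p,T)X` with `Sel_∞[p]^Γ`), transported along
`Sel_{p^∞}(E/K_0) ≃ Sel_{p^∞}(E/K)` (`nonempty_selmerLayer_zero_addEquiv`); `(p, T^{p⁰}) = (p, T)`.
[cite: GreenbergLNM1716, §1 p. 60, Thm. 1.2 and §3 pp. 85–86] -/
theorem finite_and_natCard_selmerGroupPInfty_torsion_le (D : W.SelmerDualData κ γ)
    [Module.Finite (IwasawaAlgebra p) D.X] (hK : ∀ P : W.toAffine.Point, p • P = 0 → P = 0) :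
    Finite {z : W.selmerGroupPInfty p // p • z = 0} ∧
      Nat.card {z : W.selmerGroupPInfty p // p • z = 0} ≤
        Nat.card (D.X ⧸ (towerIdeal p 1 • ⊤ : Submodule (IwasawaAlgebra p) D.X)) := by
  obtain ⟨hfin, hle⟩ := KatoHalfPinch.finite_and_natCard_selmerLayer_pTorsion_le W κ D hK 0
  rw [pow_zero] at hle
  obtain ⟨e⟩ := W.nonempty_selmerLayer_zero_addEquiv (p := p) κ
  let e' : {z : W.selmerLayer κ 0 // p • z = 0} ≃ {z : W.selmerGroupPInfty p // p • z = 0} :=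
    e.toEquiv.subtypeEquiv fun z ↦ by
      have h2 : e (p • z) = p • e z := e.toAddMonoidHom.map_nsmul p z
      change p • z = 0 ↔ p • e z = 0
      rw [← h2, e.map_eq_zero_iff]
  refine ⟨Finite.of_equiv _ e', ?_⟩
  rw [← Nat.card_congr e']
  exact hle

end Selmer

/-! ### §2 `n ≤ λ(X(E/ℚ_∞))` from Greenberg Prop. 4.14 and a Selmer count (any `p`) -/

section Lambda

variable (W : WeierstrassCurve ℚ) [W.IsElliptic] [W.IsGloballyMinimal] (p : ℕ) [hp : Fact p.Prime]

/-- **`pⁿ ≤ #Sel_{p^∞}(E/ℚ)[p] ⇒ n ≤ λ(X)` at a torsion datum with `μ(X) = 0`** — for `W/ℚ` with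
`p ∤ #E(ℚ)_tors` (`htors`), granted the PUBLISHED Greenberg 1999 Prop. 4.14 (`h414`: `X` torsion ⇒ no
non-zero finite `Λ`-submodule), for the cyclotomic `κ` with topological generator `γ` and a dual
datum `D` with `X` torsion (`hX`) and `μ(X) = 0` (`hμ`): `pⁿ ≤ #Sel_{p^∞}(E/ℚ)[p] ≤ #X/(p,T)X ≤
#X/pX = p^{λ(X)}`. The odd-`p` twin of the `bsd-2adic` cell's
`MultSelmerRank.selmerLambdaLowerBoundAtTwo_of_selmerTwoTorsion`; the `μ = 0` case of Kundu–Ray's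
Lemma 2.1 `λ + μ ≥ g`. [cite: GreenbergLNM1716, Prop. 4.14 (p. 124), §1 p. 60 and §3 pp. 85–86]
[cite: Washington1997, §13.2] [cite: KunduRay2024, Lemma 2.1] -/
theorem le_lambda_of_prop414_of_selmerGroupPInfty
    (h414 : prop414_noFiniteSubmodule_of_not_dvd_torsionOrder) (htors : ¬ p ∣ W.torsionOrder)
    {n : ℕ} (hsel : p ^ n ≤ Nat.card {z : W.selmerGroupPInfty p // p • z = 0})
    {κ : ZpExtension ℚ p} {γ : Field.absoluteGaloisGroup ℚ} (hκ : κ.IsCyclotomic)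
    (hγ : κ.IsTopGenerator γ) (D : W.SelmerDualData κ γ) (hX : D.IsTorsion) (hμ : D.mu = 0) :
    n ≤ D.lambda := by
  haveI : Module.Finite (IwasawaAlgebra p) D.X := D.module_finite_holds hγ
  have hK := Iwasawa.forall_smul_eq_zero_imp_of_not_dvd_torsionOrder W htors
  obtain ⟨-, hle⟩ := finite_and_natCard_selmerGroupPInfty_torsion_le W κ D hK
  exact KatoHalfPinch.le_lambdaInvariant_of_pow_le_natCard_quotient_towerIdeal p hX hμ
    (fun N hN ↦ h414 W p htors κ γ hκ hγ D hX N hN) (hsel.trans hle)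

/-- **Rank `0`: `pⁿ ≤ #Sel^(p)(E/ℚ) ⇒ n ≤ λ(X)`.** As `le_lambda_of_prop414_of_selmerGroupPInfty`, with
the certificate spelled on the `p`-SELMER GROUP `Sel^(p)(E/ℚ) ⊆ H¹(ℚ, E[p])` (the object an explicit
`p`-descent computes): at Mordell–Weil rank `0` (`hrk`) with `E[p]` irreducible (`hirr`, so
`E(ℚ)[p] = 0`, `natCard_torsionBy_eq_one_of_irr`) the descent count `#Sel^(p) = p^{rank}·#E(ℚ)[p]·#Ш[p]`
(`card_selmerGroup_eq_pow_rank_mul`, Silverman X.4.2 (a)) reads `#Sel^(p) = #Ш[p] ≤ #Sel_{p^∞}[p]`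
(§1). [cite: SilvermanAEC2009, Thm. X.4.2 (a)] [cite: GreenbergLNM1716, Prop. 4.14 (p. 124)] -/
theorem le_lambda_of_prop414_of_selmerGroup_of_rankZero
    (h414 : prop414_noFiniteSubmodule_of_not_dvd_torsionOrder) (hirr : Irr W p)
    (hrk : W.mordellWeilRank = 0) {n : ℕ} (hSel : p ^ n ≤ Nat.card (W.selmerGroup (p : ℤ)))
    {κ : ZpExtension ℚ p} {γ : Field.absoluteGaloisGroup ℚ} (hκ : κ.IsCyclotomic)
    (hγ : κ.IsTopGenerator γ) (D : W.SelmerDualData κ γ) (hX : D.IsTorsion) (hμ : D.mu = 0) :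
    n ≤ D.lambda := by
  have hpP : p.Prime := Fact.out
  haveI : NeZero p := ⟨hpP.ne_zero⟩
  haveI : Module.Finite (IwasawaAlgebra p) D.X := D.module_finite_holds hγ
  have htors : ¬ p ∣ W.torsionOrder :=
    fun h ↦ not_hasIrreducibleModPGaloisRep_of_dvd_torsionOrder W p h hirr
  have hK := Iwasawa.forall_smul_eq_zero_imp_of_not_dvd_torsionOrder W htors
  obtain ⟨hfin, -⟩ := finite_and_natCard_selmerGroupPInfty_torsion_le W κ D hK
  -- the descent count at rank `0` without rational `p`-torsion: `#Sel^(p) = #Ш[p]`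
  have hcount := card_selmerGroup_eq_pow_rank_mul W p
  rw [natCard_torsionBy_eq_one_of_irr W _ p hirr, mul_one, hrk, pow_zero, one_mul] at hcount
  have hsel : p ^ n ≤ Nat.card {z : W.selmerGroupPInfty p // p • z = 0} := by
    refine hSel.trans ?_
    rw [hcount]
    exact natCard_sha_inf_torsionBy_le_natCard_selmerGroupPInfty_torsion W p
  exact le_lambda_of_prop414_of_selmerGroupPInfty W p h414 htors hsel hκ hγ D hX hμ

end Lambda

/-! ### §3 The pinch: Kato 17.4 (3) + `μ_an = 0` + `λ_an = n ≤ λ(X)` ⇒ `char_Λ X = (ϖ·L_p)` (odd `p`) -/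

section Pinch

variable (W : WeierstrassCurve ℚ) [W.IsElliptic] [W.IsGloballyMinimal] (p : ℕ) [hp : Fact p.Prime]

/-- **Mazur's main conjecture AT A CYCLOTOMIC DATUM from Kato's integral divisibility and the
`λ`-certificate.** `W/ℚ` globally minimal, `p ≠ 2` good ordinary, `E[p]` irreducible (`hirr`, for the
period unit: Mazur 1978 Cor. 4.1, `hM`, via `SkinnerUrban2014.periodUnit_of_mazur`), `ρ_{E,p^n}` onto
for all `n` (`hsurj`, Kato's (12.5.2)); Kato Thm. 17.4 (3) at this datum and newform (`hK`);
certificates `λ_an = n` (`hlan`) and `μ_an = 0` (`hμan`); and the algebraic input `n ≤ λ(X)` whenever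
`X` is torsion with `μ(X) = 0` (`hlamge`, e.g. §2). Then `X` is torsion, `μ(X) = 0`, `λ(X) = n`, and
`char_Λ X = (L₀)` for some `L₀ ∈ Λ` with `ι L₀ = ϖ · L_p(f, α)` (module docstring, steps 1–4).
[cite: Kato2004Asterisque, Thm. 17.4 (3) (p. 273)] [cite: Mazur1978, Cor. 4.1]
[cite: GreenbergVatsal2000, p. 4 (after Thm. (1.2))] [cite: Washington1997, §13.2] -/
theorem charIdeal_eq_span_of_kato_of_lambda_le (hM : mazur_not_dvd_maninConstant_of_odd)
    (hpodd : p ≠ 2) (hgo : GoodOrd W p) (hirr : Irr W p)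
    (hsurj : ∀ n : ℕ, W.HasSurjectiveModNGaloisRep (p ^ n : ℕ))
    {κ : ZpExtension ℚ p} {γ : Field.absoluteGaloisGroup ℚ} (hκ : κ.IsCyclotomic)
    (hγ : κ.IsTopGenerator γ) (hγ' : IsCyclotomicVariable p γ) [NeZero (W.conductorNorm ℤ)]
    {f : CuspForm (Gamma0 (W.conductorNorm ℤ)) 2} (hf : IsNewformOf W f)
    (hK : kato_divisibility W p (κ := κ) (γ := γ) (f := f))
    {ϖ : ℚ} (hϖ : (ϖ : ℝ) * W.realPeriodRat = plusPeriod f)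
    {n : ℕ} (hlan : AnalyticLambdaEq W p n) (hμan : AnalyticMuLE W p 0) (D : W.SelmerDualData κ γ)
    (hlamge : D.IsTorsion → D.mu = 0 → n ≤ D.lambda) :
    D.IsTorsion ∧ D.mu = 0 ∧ D.lambda = n ∧
      ∃ L₀ : IwasawaAlgebra p, D.charIdeal = Ideal.span {L₀} ∧
        iwasawaToPowerSeries p L₀ =
          PowerSeries.C (ϖ : ℚ_[p]) * padicLFunction f (unitRoot W p : ℚ_[p]) := by
  haveI : Module.Finite (IwasawaAlgebra p) D.X := D.module_finite_holds hγ
  -- the period ratio is a non-zero `p`-adic unit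
  have hϖ0 : ϖ ≠ 0 := varpi_ne_zero hf hϖ
  have hϖv : padicValRat p ϖ = 0 :=
    SkinnerUrban2014.periodUnit_of_mazur hM W p hpodd hgo.1 hirr f hf ϖ hϖ
  -- Kato 17.4 (3): `X` torsion, `L₀ := ϖ · L_p ∈ char X`
  obtain ⟨hX, L₀, hL₀mem, hL₀⟩ := divisibility_of_kato_of_surjective_pow W p hK hpodd hgo.1 hgo.2
    hsurj hκ hγ hγ' hf D ϖ hϖ0 hϖv
  -- the certificate `μ(L₀) = 0`, hence `L₀ ≠ 0`
  obtain ⟨k, hk⟩ := hμan f hf ϖ hϖ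
  rw [← hL₀] at hk
  have hμL₀ : mu L₀ = 0 := Nat.le_zero.mp (mu_le_of_lt_norm_coeff hk)
  have hL₀0 : L₀ ≠ 0 := by
    rintro rfl
    rw [map_zero, map_zero, norm_zero] at hk
    exact not_le.mpr hk (by positivity)
  -- a generator `f_X` of `char X`
  haveI : (Module.charIdeal (IwasawaAlgebra p) D.X).IsPrincipal := charIdeal_isPrincipal_holds p D.X
  obtain ⟨fX, hfX⟩ := Submodule.IsPrincipal.principal (Module.charIdeal (IwasawaAlgebra p) D.X)
  have hchar : D.charIdeal = Ideal.span {fX} := hfX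
  have hfX0 : fX ≠ 0 := by
    intro h0
    refine Module.charIdeal_ne_bot (IwasawaAlgebra p) D.X ?_
    change D.charIdeal = ⊥
    rw [hchar, h0]
    exact Ideal.span_singleton_eq_bot.mpr rfl
  -- `L₀ = b · f_X`, so `μ(f_X) ≤ μ(L₀) = 0`, i.e. `μ(X) = 0`
  rw [hchar] at hL₀mem
  obtain ⟨b, hb⟩ := Ideal.mem_span_singleton'.mp hL₀mem
  have hb0 : b ≠ 0 := by
    rintro rfl
    exact hL₀0 (by rw [← hb, zero_mul])
  have hμfX : mu fX = 0 := by
    have hle : mu fX ≤ mu (fX * b) := mu_le_mu_mul hfX0 hb0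
    rw [mul_comm, hb, hμL₀] at hle
    exact Nat.le_zero.mp hle
  have hμX : D.mu = 0 := by
    rw [mu_generator_eq_muInvariant D.X hX hfX0 hchar] at hμfX
    exact hμfX
  -- `λ(L₀) = n ≤ λ(X) = λ(f_X)`
  have hlamfX : lam fX = D.lambda := lam_generator_eq_lambdaInvariant D.X hX hfX0 hchar
  have hlan' : lam L₀ = n := hlan f hf ϖ hϖ L₀ hL₀
  have hle : lam L₀ ≤ lam fX := by
    rw [hlan', hlamfX]
    exact hlamge hX hμX
  -- the pinch
  obtain ⟨hspan, hlameq⟩ :=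
    KatoHalfPinch.span_eq_span_of_mem_span_of_mu_eq_zero_of_lam_le hL₀mem hfX0 hL₀0 hμL₀ hμfX hle
  refine ⟨hX, hμX, ?_, L₀, by rw [hchar, hspan], hL₀⟩
  rw [← hlamfX, ← hlameq, hlan']

/-- **Mazur's main conjecture for `(E,p)` from Kato 17.4 (3) and the `λ`-certificate** (every
cyclotomic datum): PUBLISHED inputs Kato Thm. 17.4 (3) (`hK`, for the newform at level `N_E` and every
cyclotomic datum) and Mazur 1978 Cor. 4.1 (`hM`); decidable data `p ≠ 2`, good ordinary, `E[p]`
irreducible, `ρ_{E,p^∞}` onto (`hsurj`); certificates `λ_an = n`, `μ_an = 0`; and the algebraic input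
`n ≤ λ(X)` at every cyclotomic torsion datum with `μ = 0` (`hlamge`). [cite: Kato2004Asterisque, Thm. 17.4 (3) (p. 273)]
[cite: GreenbergVatsal2000, p. 4 (after Thm. (1.2))] [cite: Mazur1978, Cor. 4.1] -/
theorem mazurMainConjecture_of_kato_of_lambda_le (hM : mazur_not_dvd_maninConstant_of_odd)
    (hK : ∀ (κ : ZpExtension ℚ p) (γ : Field.absoluteGaloisGroup ℚ) [NeZero (W.conductorNorm ℤ)]
      (f : CuspForm (Gamma0 (W.conductorNorm ℤ)) 2), kato_divisibility W p (κ := κ) (γ := γ) (f := f))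
    (hpodd : p ≠ 2) (hgo : GoodOrd W p) (hirr : Irr W p)
    (hsurj : ∀ n : ℕ, W.HasSurjectiveModNGaloisRep (p ^ n : ℕ))
    {n : ℕ} (hlan : AnalyticLambdaEq W p n) (hμan : AnalyticMuLE W p 0)
    (hlamge : ∀ (κ : ZpExtension ℚ p) (γ : Field.absoluteGaloisGroup ℚ), κ.IsCyclotomic →
      κ.IsTopGenerator γ → ∀ D : W.SelmerDualData κ γ, D.IsTorsion → D.mu = 0 → n ≤ D.lambda) :
    MazurMainConjecture W p := by
  intro κ γ hκ hγ hγ' _ f hf ϖ hϖ D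
  obtain ⟨hX, -, -, L₀, hchar, hL₀⟩ := charIdeal_eq_span_of_kato_of_lambda_le W p hM hpodd hgo hirr
    hsurj hκ hγ hγ' hf (hK κ γ f) hϖ hlan hμan D (hlamge κ γ hκ hγ D)
  exact ⟨hX, L₀, hchar, hL₀⟩

/-- **ROAD (L), Selmer form: Mazur's main conjecture for `(E,p)` from PRINT {Kato 17.4 (3), Greenberg
Prop. 4.14, Mazur 1978 Cor. 4.1} + CERTIFICATES {`λ_an = n`, `μ_an = 0`, `pⁿ ≤ #Sel_{p^∞}(E/ℚ)[p]`}**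
at an odd good ordinary `p` with `E[p]` irreducible and `ρ_{E,p^∞}` onto — any analytic rank, no
partner, no pairing, no `#Ш_an`. [cite: Kato2004Asterisque, Thm. 17.4 (3) (p. 273)]
[cite: GreenbergLNM1716, Prop. 4.14 (p. 124)] [cite: Mazur1978, Cor. 4.1] -/
theorem mazurMainConjecture_of_kato_of_selmerGroupPInfty (hM : mazur_not_dvd_maninConstant_of_odd)
    (h414 : prop414_noFiniteSubmodule_of_not_dvd_torsionOrder)
    (hK : ∀ (κ : ZpExtension ℚ p) (γ : Field.absoluteGaloisGroup ℚ) [NeZero (W.conductorNorm ℤ)]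
      (f : CuspForm (Gamma0 (W.conductorNorm ℤ)) 2), kato_divisibility W p (κ := κ) (γ := γ) (f := f))
    (hpodd : p ≠ 2) (hgo : GoodOrd W p) (hirr : Irr W p)
    (hsurj : ∀ n : ℕ, W.HasSurjectiveModNGaloisRep (p ^ n : ℕ))
    {n : ℕ} (hlan : AnalyticLambdaEq W p n) (hμan : AnalyticMuLE W p 0)
    (hsel : p ^ n ≤ Nat.card {z : W.selmerGroupPInfty p // p • z = 0}) :
    MazurMainConjecture W p := by
  have htors : ¬ p ∣ W.torsionOrder :=
    fun h ↦ not_hasIrreducibleModPGaloisRep_of_dvd_torsionOrder W p h hirr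
  exact mazurMainConjecture_of_kato_of_lambda_le W p hM hK hpodd hgo hirr hsurj hlan hμan
    fun κ γ hκ hγ D hX hμ ↦ le_lambda_of_prop414_of_selmerGroupPInfty W p h414 htors hsel hκ hγ D hX hμ

/-- **ROAD (L), descent form at analytic rank `0`: Mazur's main conjecture for `(E,p)` from PRINT
{Kato 17.4 (3), Greenberg Prop. 4.14, Mazur 1978 Cor. 4.1, Gross–Zagier–Kolyvagin} + CERTIFICATES
{`λ_an = n`, `μ_an = 0`, `pⁿ ≤ #Sel^(p)(E/ℚ)`}** (the last one a LOWER bound for the `p`-Selmer group: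
`n` independent elements of an explicit `p`-descent — GRH-free), at an odd good ordinary `p` with `E[p]`
irreducible, `ρ_{E,p^∞}` onto and `ord_{s=1} L(E,s) = 0` (GZK: `E(ℚ)` has rank `0`).
[cite: Kato2004Asterisque, Thm. 17.4 (3) (p. 273)] [cite: GreenbergLNM1716, Prop. 4.14 (p. 124)]
[cite: Mazur1978, Cor. 4.1] [cite: SilvermanAEC2009, Thm. X.4.2 (a)] -/
theorem mazurMainConjecture_of_kato_of_selmerGroup_of_rankZero
    (hM : mazur_not_dvd_maninConstant_of_odd) (h414 : prop414_noFiniteSubmodule_of_not_dvd_torsionOrder)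
    (hGZK : rank_eq_analyticRank_of_analyticRank_le_one)
    (hK : ∀ (κ : ZpExtension ℚ p) (γ : Field.absoluteGaloisGroup ℚ) [NeZero (W.conductorNorm ℤ)]
      (f : CuspForm (Gamma0 (W.conductorNorm ℤ)) 2), kato_divisibility W p (κ := κ) (γ := γ) (f := f))
    (hpodd : p ≠ 2) (hgo : GoodOrd W p) (hirr : Irr W p)
    (hsurj : ∀ n : ℕ, W.HasSurjectiveModNGaloisRep (p ^ n : ℕ)) (hr0 : W.analyticRank = 0)
    {n : ℕ} (hlan : AnalyticLambdaEq W p n) (hμan : AnalyticMuLE W p 0)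
    (hSel : p ^ n ≤ Nat.card (W.selmerGroup (p : ℤ))) : MazurMainConjecture W p := by
  have hrk : W.mordellWeilRank = 0 := by rw [(hGZK W (by omega)).1, hr0]
  exact mazurMainConjecture_of_kato_of_lambda_le W p hM hK hpodd hgo hirr hsurj hlan hμan
    fun κ γ hκ hγ D hX hμ ↦
      le_lambda_of_prop414_of_selmerGroup_of_rankZero W p h414 hirr hrk hSel hκ hγ D hX hμ

end Pinch

/-! ### §4 Row C16 at `p = 3`, analytic rank `0`: `BSD(E,3)` by road (L) -/

section RowC16

variable (W : WeierstrassCurve ℚ) [W.IsElliptic] [W.IsGloballyMinimal]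

/-- **Row C16 ∩ {r_an = 0} at `p = 3` WITHOUT Beilinson–Flach and WITHOUT a partner: `BSD(E,3)` by the
`λ`-structure road.** Inputs BY NAME (all PUBLISHED, `p = 3` inside every printed range): Kato 2004
Thm. 17.4 (3) for this curve (`hK`), Greenberg 1999 Prop. 4.14 (`h414`) and Thm. 4.1 (`hGr`), Mazur
1978 Cor. 4.1 (`hM`), modularity with an integral Manin constant (`hmod`), Gross–Zagier–Kolyvagin
(`hGZK`); Wuthrich 2014 Lemma 20 is the tree THEOREM `lemma20_surjective_threeAdic_of_semistable_holds`.
Class hypothesis `RowC16 W 3` (good ordinary at `3`, `E[3]` irreducible, surj(3) — in the (ram) case by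
`surj_of_irr_of_ram`); per curve: `r_an = 0` and the CERTIFICATES `λ_an(E,3) = n` (`hlan`),
`μ_an(E,3) = 0` (`hμan`), `3ⁿ ≤ #Sel^(3)(E/ℚ)` (`hSel`): `MazurMainConjecture W 3` (§3), then
`RowC16.bsdp_rankZero_of_mazurMainConjecture`. No hypothesis on `#Ш_an`, no Cassels–Tate, no
Greenberg–Vatsal, no Yan–Zhu fact. Instance of record: `384400cx1` (`n = 2`). PER CURVE; NOT a class theorem.
[cite: Kato2004Asterisque, Thm. 17.4 (3) (p. 273)] [cite: GreenbergLNM1716, Thm. 4.1 (p. 102), Prop. 4.14 (p. 124)]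
[cite: Mazur1978, Cor. 4.1] [cite: Wuthrich2014, Lemma 20 (p. 400)] [cite: CastellaEtAl2021, Thm. 5.1.4 (proof)]
[cite: Miller2011LMS, Def. 1.1] -/
theorem RowC16.bsdp_three_rankZero_of_kato_of_lambda_selmer_certificate
    (hGr : greenberg_charValue_rankZero) (hmod : nonempty_modularParametrizationData)
    (hGZK : rank_eq_analyticRank_of_analyticRank_le_one) (hM : mazur_not_dvd_maninConstant_of_odd)
    (h414 : prop414_noFiniteSubmodule_of_not_dvd_torsionOrder)
    (hK : ∀ (κ : ZpExtension ℚ 3) (γ : Field.absoluteGaloisGroup ℚ) [NeZero (W.conductorNorm ℤ)]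
      (f : CuspForm (Gamma0 (W.conductorNorm ℤ)) 2), kato_divisibility W 3 (κ := κ) (γ := γ) (f := f))
    (h : RowC16 W 3) (hr0 : W.analyticRank = 0)
    {n : ℕ} (hlan : AnalyticLambdaEq W 3 n) (hμan : AnalyticMuLE W 3 0)
    (hSel : 3 ^ n ≤ Nat.card (W.selmerGroup ((3 : ℕ) : ℤ))) : BSDp W 3 := by
  have hgo : GoodOrd W 3 := h.2.1
  have hirr : Irr W 3 := h.2.2.1
  have hsurj : Surj W 3 := by
    rcases h.2.2.2 with hs3 | hram
    · exact hs3
    · exact surj_of_irr_of_ram W 3 hirr hram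
  have htower : ∀ m : ℕ, W.HasSurjectiveModNGaloisRep (3 ^ m : ℕ) :=
    lemma20_surjective_threeAdic_of_semistable_holds W (Or.inl hgo.1) hsurj
  exact RowC16.bsdp_rankZero_of_mazurMainConjecture hGr hmod hGZK h hr0
    (mazurMainConjecture_of_kato_of_selmerGroup_of_rankZero W 3 hM h414 hGZK hK (by decide) hgo hirr
      htower hr0 hlan hμan hSel)

end RowC16

end Summit.BirchSwinnertonDyer.Rank1Residual

end
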